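import Summits.BirchSwinnertonDyer.BirchSwinnertonDyer.Theorems.AdditiveBranchIMCGenusKolyvaginTransport
import Literature.NumberTheory.EllipticCurves.GrossLMS1991.HeegnerEulerSystemCongruenceImageFree
import Literature.NumberTheory.EllipticCurves.MinimalModelVariableChangeIntegralProofs
import Literature.NumberTheory.EllipticCurves.GeomPointReduction
import Literature.NumberTheory.EllipticCurves.KleinFrickeLevelTwentySeven
import Mathlib.NumberTheory.LegendreSymbol.QuadraticReciprocity
import HarnessLib

/-!
# Crux `GordTwoRankZeroOffCaseOne` (+ twin `MultLower`), line `three_field_road`: PRELIMINARIES for the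
# transport of the congruence label (B5) along the genus twist `Θ_ϑ : E′ ≅ Wd` at a place over `ℓ`

Cell `bsd-addord`, lead seat `cruxlead-19357` (g2); HELPER for the registered stub `stub_genusKolyvaginPointsR[M]`
(`Cruxes/GordTwoRankZeroOffCaseOne/Lines/three_field_road.lean`, `Cruxes/MultLower/Lines/tame_roads_mult.lean`),
landed `--supports … --as helper`. THEOREMS ONLY (no definition, no named fact, no `sorry`).

## What

The bare family of the genus line is `y″(m) = Θ_{ϑ_m}(y_{E′}(m))`, the transport of the fourth curve's CM points
along `Θ_ϑ = (C₂)_* ∘ ι_ϑ⁻¹ ∘ D_*` for the square root `ϑ_m = χ_{d₁}(m)·θ` of `d₁` (lead report 4 §2; the sign is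
absorbed into the choice of root, `Θ_{−ϑ} = −Θ_ϑ`). K4e's label (B5) for `y″` — `y″(m) ≡ Frob ȳ″(m/ℓ)` at the
places over a Kolyvagin prime `ℓ ∣ m` — is the `E′`-side congruence (Nekovář 2007 Prop. (4.9),
`Nekovar2007.cmPoint_frobeniusCongruence`, stated through the coordinate predicate `FrobCongruentModPlace 𝒪 ℓ` at
every valuation subring `𝒪` of every field `Ω` receiving `K″[m]`) TRANSPORTED along `Θ`, the change of root
`ϑ_{m/ℓ} ↦ ϑ_m = χ_{d₁}(ℓ)·ϑ_{m/ℓ}` being exactly Euler's `ϑ^ℓ ≡ (d₁/ℓ)·ϑ (mod λ)`. This file holds the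
place-generic preliminaries; the transport theorem itself is the sequel `…GenusKolyvaginTwistCongruence`.

* §1 residues along a valuation subring `O` of a field `L` with a rational prime `ℓ ∈ 𝔪_O`: `𝔪_O ∩ ℤ = (ℓ)`
  (`intCast_mem_nonunits_iff`), integers prime to `ℓ` are units, the residue field has characteristic `ℓ`,
  and **residues of `ℓ`-integral rationals are fixed by the `ℓ`-power map** (`residue_ratCast_pow_eq`);
* §2 for `ϑ² = d`, `ℓ ∤ d` odd: `ϑ` is an `O`-unit and **`ϑ̄^ℓ = (d/ℓ)·ϑ̄`** (Euler's criterion,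
  `legendreSym.eq_pow`, read in the residue field; `residue_sqrt_pow`);
* §3 `FrobCongruentModPlace` along a field map `e : L → Ω` is the same predicate at the pulled-back place
  `𝒪.comap e` (`frobCongruentModPlace_mapPointHom_iff`);
* §4 `Θ_ϑ` on affine points IS the substitution of ONE change of variables
  `T_ϑ = C₂ · ι_ϑ⁻¹ · D` over `L` (`twist_some`, `twistChange_smul`), whose coefficients are
  `u = A ϑ⁻¹`, `r = R`, `s = B ϑ + S`, `t = C ϑ + T₀` with `A, R, B, S, C, T₀ ∈ ℚ` (`twistChange_coeff`).

HONEST FRAMING: local algebra of Weierstrass equations and valuation rings (Silverman III.1, VII.1–2, X.5;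
Euler's criterion); nothing about Heegner points or BSD is asserted; no stub is closed by this file alone.
BSD is not proved by any of this.
[cite: SilvermanAEC2009, III.1 Table 3.1, VII.1 Prop. 1.3 (b), VII.2 Prop. 2.1, X.5 Cor. 5.4 (iii)]
[cite: IrelandRosen1990, Prop. 5.1.2 (Euler's criterion)] [cite: GrossLMS1991, Prop. 3.7 (2) (the congruence being transported)]
presearch: n/a (kernel algebra; `lean search 'FrobCongruentModPlace|untwistEquivAt|residue_ratCast'` → the predicate file,
the twist maps, no place-generic twist transport).
-/

noncomputable section

open scoped Classical

set_option linter.dupNamespace false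
set_option autoImplicit false

namespace Summit.BirchSwinnertonDyer.BirchSwinnertonDyer.Theorems.GenusKolyvagin

open WeierstrassCurve Literature.NumberTheory.EllipticCurves IsLocalRing

universe v

/-! ## §1 Residues along a valuation subring containing a rational prime in its maximal ideal -/

section Residue

variable {L : Type v} [Field L] (O : ValuationSubring L)

/-- `a ≡ b (mod 𝔪_O)` iff the residues agree. [folklore] -/
theorem sub_mem_nonunits_iff_residue_eq {a b : L} (ha : a ∈ O) (hb : b ∈ O) :
    a - b ∈ O.nonunits ↔ residue O ⟨a, ha⟩ = residue O ⟨b, hb⟩ := by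
  rw [← sub_eq_zero, ← map_sub, residue_eq_zero_iff, ValuationSubring.valuation_lt_one_iff,
    ValuationSubring.mem_nonunits_iff]
  rfl

/-- A product of an element of `𝔪_O` and an element of `O` lies in `𝔪_O`. [folklore] -/
theorem mul_mem_nonunits_of_mem {a b : L} (ha : a ∈ O.nonunits) (hb : b ∈ O) :
    a * b ∈ O.nonunits := by
  rw [ValuationSubring.mem_nonunits_iff] at ha ⊢
  rw [map_mul]
  have hb' : O.valuation b ≤ 1 := (O.valuation_le_one_iff b).mpr hb
  calc O.valuation a * O.valuation b ≤ O.valuation a * 1 := mul_le_mul_right hb' _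
    _ < 1 := by rw [mul_one]; exact ha

/-- A sum of two elements of `𝔪_O` lies in `𝔪_O`. [folklore] -/
theorem add_mem_nonunits {a b : L} (ha : a ∈ O.nonunits) (hb : b ∈ O.nonunits) :
    a + b ∈ O.nonunits := by
  rw [ValuationSubring.mem_nonunits_iff] at ha hb ⊢
  exact Valuation.map_add_lt _ ha hb

variable {ℓ : ℕ} (hℓ : ℓ.Prime) (hℓO : (ℓ : L) ∈ O.nonunits)
include hℓ hℓO

/-- For an integer `n`: `n ∈ 𝔪_O` iff `ℓ ∣ n` (`𝔪_O ∩ ℤ = (ℓ)`). [folklore] -/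
theorem intCast_mem_nonunits_iff (n : ℤ) : (n : L) ∈ O.nonunits ↔ (ℓ : ℤ) ∣ n := by
  constructor
  · intro hn
    by_contra hdvd
    have hcop : IsCoprime (ℓ : ℤ) n := by
      rw [Int.isCoprime_iff_gcd_eq_one]
      have h1 : ¬ ℓ ∣ n.natAbs := fun h => hdvd (Int.ofNat_dvd_left.mpr h)
      exact (Nat.Prime.coprime_iff_not_dvd hℓ).mpr h1
    obtain ⟨a, b, hab⟩ := hcop
    have h1 : (1 : L) ∈ O.nonunits := by
      have : (1 : L) = (a : L) * ℓ + (b : L) * n := by exact_mod_cast congrArg (Int.cast (R := L)) hab.symm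
      rw [this]
      exact add_mem_nonunits O (by rw [mul_comm]; exact mul_mem_nonunits_of_mem O hℓO (intCast_mem O a))
        (by rw [mul_comm]; exact mul_mem_nonunits_of_mem O hn (intCast_mem O b))
    rw [ValuationSubring.mem_nonunits_iff, map_one] at h1
    exact lt_irrefl _ h1
  · rintro ⟨k, rfl⟩
    push_cast
    exact mul_mem_nonunits_of_mem O hℓO (intCast_mem O k)

/-- An integer prime to `ℓ` is a unit of `O`: valuation `1`. [folklore] -/
theorem valuation_intCast_eq_one {n : ℤ} (hn : ¬ (ℓ : ℤ) ∣ n) : O.valuation (n : L) = 1 := by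
  have hle : O.valuation (n : L) ≤ 1 := (O.valuation_le_one_iff _).mpr (intCast_mem O n)
  rcases hle.lt_or_eq with h | h
  · exact absurd ((intCast_mem_nonunits_iff O hℓ hℓO n).mp (O.mem_nonunits_iff.mpr h)) hn
  · exact h

/-- The residue field of `O` has characteristic `ℓ`. [folklore] -/
theorem charP_residueField : CharP (ResidueField O) ℓ := by
  refine (CharP.charP_iff_prime_eq_zero hℓ).mpr ?_
  have h : ((ℓ : ℤ) : L) ∈ O.nonunits := by exact_mod_cast hℓO
  have := (sub_mem_nonunits_iff_residue_eq O (intCast_mem O ℓ) O.zero_mem).mp (by simpa using h)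
  have h0 : (⟨(0 : L), O.zero_mem⟩ : O) = 0 := rfl
  have h2 : (⟨((ℓ : ℤ) : L), intCast_mem O ℓ⟩ : O) = ((ℓ : ℕ) : O) := Subtype.ext (by simp)
  rw [h0, map_zero, h2, map_natCast] at this
  exact this

/-- Residues of `ℓ`-integral RATIONAL numbers are fixed by the `ℓ`-power map. [folklore] -/
theorem residue_ratCast_pow_eq [CharZero L] (z : ℚ) (hz : (z : L) ∈ O) :
    residue O ⟨(z : L), hz⟩ ^ ℓ = residue O ⟨(z : L), hz⟩ := by
  haveI := charP_residueField O hℓ hℓO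
  haveI : ExpChar (ResidueField O) ℓ := ExpChar.prime hℓ
  -- the denominator is an `ℓ`-unit
  have hden : ¬ (ℓ : ℤ) ∣ (z.den : ℤ) := by
    intro hd
    have hdn : ((z.den : ℤ) : L) ∈ O.nonunits := (intCast_mem_nonunits_iff O hℓ hℓO _).mpr hd
    have hnum : ((z.num : ℤ) : L) ∈ O.nonunits := by
      have : ((z.num : ℤ) : L) = ((z.den : ℤ) : L) * (z : L) := by
        rw [Int.cast_natCast, mul_comm]
        exact_mod_cast (Rat.mul_den_eq_num z).symm
      rw [this]
      exact mul_mem_nonunits_of_mem O hdn hz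
    have hn := (intCast_mem_nonunits_iff O hℓ hℓO _).mp hnum
    have hcop := z.reduced
    have h1 : ℓ ∣ Nat.gcd z.num.natAbs z.den :=
      Nat.dvd_gcd (Int.ofNat_dvd_left.mp hn) (by exact_mod_cast hd)
    rw [hcop] at h1
    exact hℓ.one_lt.ne' (Nat.dvd_one.mp h1)
  have hvden : O.valuation ((z.den : ℤ) : L) = 1 := valuation_intCast_eq_one O hℓ hℓO hden
  set D : O := ⟨((z.den : ℤ) : L), intCast_mem O _⟩ with hDdef
  set Nn : O := ⟨((z.num : ℤ) : L), intCast_mem O _⟩ with hNdef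
  have hDu : IsUnit D := (O.valuation_eq_one_iff D).mpr hvden
  have hDres : residue O D ≠ 0 := by
    rw [Ne, residue_eq_zero_iff]
    exact fun h => (IsLocalRing.mem_maximalIdeal _).mp h hDu
  have hzD : (⟨(z : L), hz⟩ : O) * D = Nn := by
    apply Subtype.ext
    show (z : L) * ((z.den : ℤ) : L) = ((z.num : ℤ) : L)
    rw [Int.cast_natCast]
    exact_mod_cast Rat.mul_den_eq_num z
  have hD' : D = ((z.den : ℕ) : O) := Subtype.ext (by simp [hDdef])
  have hN' : Nn = ((z.num : ℤ) : O) := Subtype.ext (by simp [hNdef])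
  have key : residue O ⟨(z : L), hz⟩ = residue O Nn / residue O D := by
    rw [eq_div_iff hDres, ← map_mul, hzD]
  rw [key, hD', hN', map_natCast, map_intCast, div_pow, ← frobenius_def, ← frobenius_def,
    map_natCast, map_intCast]

end Residue

/-! ## §2 The square root `ϑ` of `d`: an `ℓ`-unit with `ϑ^ℓ ≡ (d/ℓ)·ϑ` (Euler's criterion) -/

section Sqrt

variable {L : Type v} [Field L] (O : ValuationSubring L) {ℓ : ℕ} [Fact ℓ.Prime]
  (hℓO : (ℓ : L) ∈ O.nonunits) {d : ℤ} (hℓd : ¬ (ℓ : ℤ) ∣ d) {ϑ : L} (hϑ2 : ϑ ^ 2 = (d : L))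
include hℓO hℓd hϑ2

/-- `ϑ` is an `ℓ`-unit: valuation `1` (as `ϑ² = d` with `ℓ ∤ d`). [folklore] -/
theorem valuation_sqrt_eq_one : O.valuation ϑ = 1 := by
  have h := valuation_intCast_eq_one O (Fact.out) hℓO hℓd
  rw [← hϑ2, map_pow] at h
  rcases pow_eq_one_iff.mp h with h' | h'
  · exact h'
  · exact absurd h' two_ne_zero

/-- `ϑ ∈ O`. [folklore] -/
theorem sqrt_mem : ϑ ∈ O :=
  (O.valuation_le_one_iff ϑ).mp (valuation_sqrt_eq_one O hℓO hℓd hϑ2).le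

/-- `ϑ⁻¹ ∈ O`. [folklore] -/
theorem sqrt_inv_mem : ϑ⁻¹ ∈ O :=
  (O.valuation_le_one_iff ϑ⁻¹).mp (by rw [map_inv₀, valuation_sqrt_eq_one O hℓO hℓd hϑ2, inv_one])

/-- **Euler's criterion on the residue of `ϑ = √d`**: `ϑ̄^ℓ = (d/ℓ)·ϑ̄` in the residue field (`ℓ` odd).
[folklore] -/
theorem residue_sqrt_pow (hℓ2 : ℓ ≠ 2) :
    residue O ⟨ϑ, sqrt_mem O hℓO hℓd hϑ2⟩ ^ ℓ =
      ((legendreSym ℓ d : ℤ) : ResidueField O) * residue O ⟨ϑ, sqrt_mem O hℓO hℓd hϑ2⟩ := by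
  have hℓ : ℓ.Prime := Fact.out
  haveI := charP_residueField O hℓ hℓO
  have hodd : ℓ = 2 * (ℓ / 2) + 1 := by
    have := Nat.Prime.eq_one_or_self_of_dvd hℓ 2
    omega
  have hd2 : residue O ⟨ϑ, sqrt_mem O hℓO hℓd hϑ2⟩ ^ 2 = ((d : ℤ) : ResidueField O) := by
    rw [← map_pow, ← map_intCast (residue O) d]
    congr 1
    exact Subtype.ext (by simp [hϑ2])
  have heuler : ((d : ℤ) : ResidueField O) ^ (ℓ / 2) = ((legendreSym ℓ d : ℤ) : ResidueField O) := by
    have h := congrArg (ZMod.castHom (dvd_refl ℓ) (ResidueField O)) (legendreSym.eq_pow ℓ d)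
    rw [map_pow, map_intCast, map_intCast] at h
    exact h.symm
  set z := residue O ⟨ϑ, sqrt_mem O hℓO hℓd hϑ2⟩ with hz
  calc z ^ ℓ = z ^ (2 * (ℓ / 2) + 1) := by rw [← hodd]
    _ = (z ^ 2) ^ (ℓ / 2) * z := by rw [pow_succ, pow_mul]
    _ = _ := by rw [hd2, heuler]

end Sqrt

/-! ## §3 `FrobCongruentModPlace` along a field homomorphism: pull the place back -/

section Comap

variable {L : Type v} {Ω : Type*} [Field L] [Field Ω] (e : L →+* Ω) (𝒪 : ValuationSubring Ω)

/-- `x ∈ (𝒪.comap e).nonunits ↔ e x ∈ 𝒪.nonunits`. [folklore] -/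
theorem mem_nonunits_comap_iff (x : L) : x ∈ (𝒪.comap e).nonunits ↔ e x ∈ 𝒪.nonunits := by
  rw [ValuationSubring.mem_nonunits_iff_or, ValuationSubring.mem_nonunits_iff_or,
    ValuationSubring.mem_comap, map_inv₀, map_eq_zero_iff e e.injective]

/-- **The coordinate congruence along `e : L → Ω` is the congruence at the pulled-back place
`𝒪 ∩ L`** (`mapPointHom` is `(x, y) ↦ (e x, e y)`). [folklore] -/
theorem frobCongruentModPlace_mapPointHom_iff (q : ℕ) (V : WeierstrassCurve L)
    (P Q : V.toAffine.Point) :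
    FrobCongruentModPlace 𝒪 q (V.mapPointHom e P) (V.mapPointHom e Q) ↔
      FrobCongruentModPlace (𝒪.comap e) q P Q := by
  have hmem : ∀ x : L, e x ∈ 𝒪 ↔ x ∈ 𝒪.comap e := fun x => ValuationSubring.mem_comap.symm
  have hnu : ∀ x : L, e x ∈ 𝒪.nonunits ↔ x ∈ (𝒪.comap e).nonunits :=
    fun x => (mem_nonunits_comap_iff e 𝒪 x).symm
  rcases P with _ | ⟨x₁, y₁, h₁⟩ <;> rcases Q with _ | ⟨x₂, y₂, h₂⟩
  · simp only [← Affine.Point.zero_def, map_zero, frobCongruentModPlace_zero_zero]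
  · rw [← Affine.Point.zero_def, map_zero, mapPointHom_some, frobCongruentModPlace_zero_some,
      frobCongruentModPlace_zero_some, hmem]
  · rw [← Affine.Point.zero_def, map_zero, mapPointHom_some, frobCongruentModPlace_some_zero,
      frobCongruentModPlace_some_zero, hmem]
  · rw [mapPointHom_some, mapPointHom_some, frobCongruentModPlace_some_some,
      frobCongruentModPlace_some_some, ← map_pow, ← map_pow, ← map_sub, ← map_sub, hmem, hmem, hmem,
      hmem, hnu, hnu]

end Comap

/-! ## §4 The transport `Θ_ϑ` as ONE change of variables `T_ϑ = C₂ · ι_ϑ⁻¹ · D` and its coefficients -/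

section Coeff

variable {F : Type*} [Field F]

/-- `ι_ϑ⁻¹` on the `x`-coordinate: `x ↦ ϑ² x`. [folklore] -/
theorem toX_untwistAt_inv {ϑ : F} (hϑ : ϑ ≠ 0) (x : F) : (untwistAt hϑ)⁻¹.toX x = ϑ ^ 2 * x := by
  simp [VariableChange.toX_def, VariableChange.inv_def, untwistAt]

/-- `ι_ϑ⁻¹` on the `y`-coordinate: `y ↦ ϑ³ y`. [folklore] -/
theorem toY_untwistAt_inv {ϑ : F} (hϑ : ϑ ≠ 0) (x y : F) :
    (untwistAt hϑ)⁻¹.toY x y = ϑ ^ 3 * y := by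
  simp [VariableChange.toY_def, VariableChange.inv_def, untwistAt]

end Coeff

section Twist

variable (E' : WeierstrassCurve ℚ) (D C₂ : VariableChange ℚ) (d : ℤ)
  {L : Type v} [Field L] [Algebra ℚ L] {ϑ : L}

/-- **`T_ϑ • E′_L = Wd_L`**: the composite change of variables `C₂ · ι_ϑ⁻¹ · D` over `L ∋ ϑ = √d` carries
`E′_L` to `(C₂ • (D • E′)^{(d)})_L`. [cite: SilvermanAEC2009, X.5 Cor. 5.4 (iii)] -/
theorem twistChange_smul [(D • E').IsCharNeTwoNF] (hϑ2 : ϑ ^ 2 = algebraMap ℚ L (d : ℚ)) (hϑ : ϑ ≠ 0) :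
    (C₂.map (algebraMap ℚ L) * ((untwistAt hϑ)⁻¹ * D.map (algebraMap ℚ L))) • E'.baseChange L =
      (C₂ • (D • E').quadraticTwist (d : ℚ)).baseChange L := by
  rw [mul_smul, mul_smul, ← VariableChange.baseChange_smul_eq E' D L,
    ← untwistAt_smul_eq (D • E') hϑ2 hϑ, inv_smul_smul, VariableChange.baseChange_smul_eq]

/-- **`Θ_ϑ` on an affine point is the substitution `T_ϑ`**: `Θ_ϑ(x, y) = (T_ϑ.toX x, T_ϑ.toY x y)`.
[cite: SilvermanAEC2009, III.1 Table 3.1, X.5 Cor. 5.4 (iii)] -/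
theorem twist_some [(D • E').IsCharNeTwoNF] (hϑ2 : ϑ ^ 2 = algebraMap ℚ L (d : ℚ)) (hϑ : ϑ ≠ 0)
    {x y : L} (h : (E'.baseChange L).toAffine.Nonsingular x y) :
    ∃ h', VariableChange.pointEquivBaseChange ((D • E').quadraticTwist (d : ℚ)) C₂ L
        (((D • E').untwistEquivAt hϑ2 hϑ).symm (VariableChange.pointEquivBaseChange E' D L (.some x y h))) =
      .some ((C₂.map (algebraMap ℚ L) * ((untwistAt hϑ)⁻¹ * D.map (algebraMap ℚ L))).toX x)
        ((C₂.map (algebraMap ℚ L) * ((untwistAt hϑ)⁻¹ * D.map (algebraMap ℚ L))).toY x y) h' := by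
  have e1 := VariableChange.pointEquivBaseChange_some E' D L h
  set Q := ((D • E').untwistEquivAt hϑ2 hϑ).symm
    (VariableChange.pointEquivBaseChange E' D L (.some x y h)) with hQdef
  have hQ' : (D • E').untwistEquivAt hϑ2 hϑ Q =
      .some ((D.map (algebraMap ℚ L)).toX x) ((D.map (algebraMap ℚ L)).toY x y)
        ((VariableChange.baseChange_smul_eq E' D L) ▸
          (VariableChange.nonsingular_iff (E'.baseChange L) (D.map (algebraMap ℚ L)) x y).mpr h) := by
    rw [hQdef, AddEquiv.apply_symm_apply, e1]
  rcases hQc : Q with _ | ⟨a, b, hab⟩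
  · rw [hQc, ← Affine.Point.zero_def, map_zero] at hQ'
    cases hQ'
  · obtain ⟨h', e'⟩ := untwistEquivAt_some (D • E') hϑ2 hϑ hab
    rw [hQc, e'] at hQ'
    simp only [Affine.Point.some.injEq] at hQ'
    obtain ⟨ha, hb⟩ := hQ'
    have hϑ2' : ϑ ^ 2 ≠ 0 := pow_ne_zero 2 hϑ
    have hϑ3' : ϑ ^ 3 ≠ 0 := pow_ne_zero 3 hϑ
    have ha' : a = ϑ ^ 2 * (D.map (algebraMap ℚ L)).toX x := by
      rw [← ha, ← mul_assoc, mul_inv_cancel₀ hϑ2', one_mul]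
    have hb' : b = ϑ ^ 3 * (D.map (algebraMap ℚ L)).toY x y := by
      rw [← hb, ← mul_assoc, mul_inv_cancel₀ hϑ3', one_mul]
    have hX : (C₂.map (algebraMap ℚ L) * ((untwistAt hϑ)⁻¹ * D.map (algebraMap ℚ L))).toX x =
        (C₂.map (algebraMap ℚ L)).toX a := by
      simp only [VariableChange.toX_mul, toX_untwistAt_inv, ← ha']
    have hY : (C₂.map (algebraMap ℚ L) * ((untwistAt hϑ)⁻¹ * D.map (algebraMap ℚ L))).toY x y =
        (C₂.map (algebraMap ℚ L)).toY a b := by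
      rw [VariableChange.toY_mul, VariableChange.toY_mul, VariableChange.toX_mul, toY_untwistAt_inv,
        toX_untwistAt_inv, ← ha', ← hb']
    have hns : ((C₂ • (D • E').quadraticTwist (d : ℚ)).baseChange L).toAffine.Nonsingular
        ((C₂.map (algebraMap ℚ L)).toX a) ((C₂.map (algebraMap ℚ L)).toY a b) :=
      (VariableChange.baseChange_smul_eq _ C₂ L) ▸
        (VariableChange.nonsingular_iff _ (C₂.map (algebraMap ℚ L)) a b).mpr hab
    refine ⟨by rw [hX, hY]; exact hns, ?_⟩
    rw [VariableChange.pointEquivBaseChange_some]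
    simp only [Affine.Point.some.injEq]
    exact ⟨hX.symm, hY.symm⟩


/-- `d ≠ 0` (a nonzero `ϑ` squares to it). [folklore] -/
theorem intCast_ne_zero_of_sq (hϑ2 : ϑ ^ 2 = algebraMap ℚ L (d : ℚ)) (hϑ : ϑ ≠ 0) :
    (algebraMap ℚ L (d : ℚ)) ≠ 0 := by
  rw [← hϑ2]; exact pow_ne_zero 2 hϑ

/-- **The coefficients of `T_ϑ = C₂ · ι_ϑ⁻¹ · D`**: `u = A·ϑ⁻¹`, `r = R`, `s = B·ϑ + S`, `t = C·ϑ + T₀` with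
the RATIONAL numbers `A = u₂u_D`, `R = r₂u_D²/d + r_D`, `B = u_D s₂/d`, `S = s_D`, `C = t₂u_D³/d²`,
`T₀ = r₂ s_D u_D²/d + t_D` (matrix product of the three substitutions, `ϑ² = d`).
[cite: SilvermanAEC2009, III.1 Table 3.1] -/
theorem twistChange_coeff (hϑ2 : ϑ ^ 2 = algebraMap ℚ L (d : ℚ)) (hϑ : ϑ ≠ 0) :
    (((C₂.map (algebraMap ℚ L) * ((untwistAt hϑ)⁻¹ * D.map (algebraMap ℚ L))).u : L) =
        algebraMap ℚ L ((C₂.u : ℚ) * D.u) * ϑ⁻¹) ∧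
    (C₂.map (algebraMap ℚ L) * ((untwistAt hϑ)⁻¹ * D.map (algebraMap ℚ L))).r =
        algebraMap ℚ L (C₂.r * (D.u : ℚ) ^ 2 / d + D.r) ∧
    (C₂.map (algebraMap ℚ L) * ((untwistAt hϑ)⁻¹ * D.map (algebraMap ℚ L))).s =
        algebraMap ℚ L ((D.u : ℚ) * C₂.s / d) * ϑ + algebraMap ℚ L D.s ∧
    (C₂.map (algebraMap ℚ L) * ((untwistAt hϑ)⁻¹ * D.map (algebraMap ℚ L))).t =
        algebraMap ℚ L (C₂.t * (D.u : ℚ) ^ 3 / d ^ 2) * ϑ +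
          algebraMap ℚ L (C₂.r * D.s * (D.u : ℚ) ^ 2 / d + D.t) := by
  have hd := intCast_ne_zero_of_sq d hϑ2 hϑ
  have hi1 : ϑ⁻¹ = ϑ / algebraMap ℚ L (d : ℚ) := by
    rw [eq_div_iff hd, ← hϑ2, pow_two, inv_mul_cancel_left₀ hϑ]
  have hi2 : ϑ⁻¹ ^ 2 = (algebraMap ℚ L (d : ℚ))⁻¹ := by rw [inv_pow, hϑ2]
  have hi3 : ϑ⁻¹ ^ 3 = ϑ / (algebraMap ℚ L (d : ℚ)) ^ 2 := by
    rw [pow_succ, hi2, hi1]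
    field_simp
  refine ⟨?_, ?_, ?_, ?_⟩
  · simp only [VariableChange.mul_def, VariableChange.inv_def, untwistAt, VariableChange.map,
      Units.val_mul, Units.coe_map, MonoidHom.coe_coe, Units.val_inv_eq_inv_val, Units.val_mk0,
      map_mul]
    ring
  · simp only [VariableChange.mul_def, VariableChange.inv_def, untwistAt, VariableChange.map,
      Units.val_mul, Units.coe_map, MonoidHom.coe_coe, Units.val_inv_eq_inv_val, Units.val_mk0,
      map_mul, map_add, map_div₀, map_pow, zero_mul, mul_pow, hi2]
    ring
  · simp only [VariableChange.mul_def, VariableChange.inv_def, untwistAt, VariableChange.map,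
      Units.val_mul, Units.coe_map, MonoidHom.coe_coe, Units.val_inv_eq_inv_val, Units.val_mk0,
      map_mul, map_div₀, mul_zero, hi1]
    ring
  · simp only [VariableChange.mul_def, VariableChange.inv_def, untwistAt, VariableChange.map,
      Units.val_mul, Units.coe_map, MonoidHom.coe_coe, Units.val_inv_eq_inv_val, Units.val_mk0,
      map_mul, map_add, map_div₀, map_pow, mul_zero, mul_pow, hi2, hi3]
    ring

end Twist

end Summit.BirchSwinnertonDyer.BirchSwinnertonDyer.Theorems.GenusKolyvagin

end
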